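import Mathlib
import Summits.NavierStokesRegularity.NavierStokesRegularity.Theorems.LerayQuarterDissipationFiniteDissipationLiouvilleVelocityLSixTools
import HarnessLib

/-!
# Crux `FiniteDissipationLiouville` (stmt-NavierStokesRegularity-22144): the stretching term of
# the localised similarity-enstrophy budget priced by the `L⁶` norm of the VELOCITY
# (`L⁶ × L³ × L²` after integration by parts) — `L⁶`-velocity threshold, file 2/3

Theorems file of route `LerayQuarterDissipation` (lead prover g16; `--supports` the crux; tool for
`…VelocityLSix`). Navier–Stokes regularity is NOT proved by anything here; no summit is.
`U = lerayOrbit V`, `Ω = lerayVorticity V = curl U`, `φ_R(y) = smoothTransition(2 − ‖y‖²/R²)`,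
`Z_R = ∫φ_R²‖Ω‖²`, `D_R = ∫φ_R²|∇Ω|²_F`, `I = ∫_{B̄_{2R}}‖Ω‖²`, `KS = SNormLESNormFDerivOfEqConst ℝ³ volume 2`.

* **`two_mul_integral_sqCutoff_stretching_le_lsix`** — if `∫‖U(s)‖⁶ ≤ w⁶` then for `R ≥ 1`, `δ > 0`:
  `2∫φ_R²⟪DUΩ,Ω⟫ ≤ 2D_R + ((27/128)(1+δ)KS²w⁴)·Z_R + 0·Z_∞ + ((2c₁²/δ + 4Cc₁)/R)·I` — move the
  derivative onto `Ω` (`integral_mul_inner_stretching_eq`), Cauchy–Schwarz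
  `∫φ²‖U‖‖DΩ‖‖Ω‖ ≤ ‖φ‖U‖‖Ω‖‖₂ √D_R`, Hölder `(3, 3/2)`: `∫‖U‖²φ²‖Ω‖² ≤ ‖U‖₆²‖φΩ‖₃²`, the `L³`
  Gagliardo–Nirenberg inequality `‖φΩ‖₃² ≤ KS‖φΩ‖₂‖D(φΩ)‖₂`
  (`Literature.Analysis.FluidPDE.integral_norm_pow_three_le_of_integrable`), the weighted product
  rule, and the quartic Young inequality with the weight that makes the dissipation cancel EXACTLY
  (`two_mul_le_of_le_mul_mul_cube`). This is lead g14's sharper Ladyzhenskaya chain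
  (`…SmallDissipationGapSharperStretching`, `θ = √K·KS^{3/2}`) with `√K·KS` REPLACED BY `‖U‖₆`:
  the dissipation constant enters that chain only through the Sobolev inequality `‖U‖₆ ≤ KS‖DU‖₂`.

HONEST FRAMING. One estimate about a HYPOTHETICAL class with Mathlib's (non-sharp) Sobolev constant;
`set_option maxHeartbeats 400000` for the one long assembly (bookkeeping, no search); nothing here
bears on Navier–Stokes regularity or blow-up; nothing is removed from the catalogued DSS wall.
References: Ladyzhenskaya 1969 §1.1; Evans 2010 §5.6.1; folklore energy method.
-/

noncomputable section

set_option linter.dupNamespace false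

namespace Summit.NavierStokesRegularity.NavierStokesRegularity.Theorems.FiniteDissipationLiouville.VelocityLSix

open MeasureTheory Set Filter Topology Metric InnerProductSpace Function Real
open scoped RealInnerProductSpace ContDiff ENNReal Laplacian
open Literature.Analysis Literature.Analysis.FluidPDE
open Summit.NavierStokesRegularity.NavierStokesRegularity.Theorems
open Summit.NavierStokesRegularity.NavierStokesRegularity.Theorems.GaussianGap
open Summit.NavierStokesRegularity.NavierStokesRegularity.Theorems.SimilarityEnstrophy
open Summit.NavierStokesRegularity.NavierStokesRegularity.Theorems.SmallDissipationGap
open Summit.NavierStokesRegularity.NavierStokesRegularity.Theorems.FiniteDissipationLiouville.VorticityAmplitude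
open Summit.NavierStokesRegularity.NavierStokesRegularity.Theorems.FiniteDissipationLiouville.VorticityLThree

variable {C : ℝ} {V : ℝ → (EuclideanSpace ℝ (Fin 3)) → (EuclideanSpace ℝ (Fin 3))}

/-! ### The stretching term priced by the `L⁶` norm of the velocity -/

section Stretching

set_option maxHeartbeats 400000 in
/-- **The stretching term against the squared cutoff, priced by `‖U(s)‖_{L⁶}`.** For
`V ∈ 𝒟_{C,K}`, a similarity time `s` with `‖U(s)‖⁶ ∈ L¹`, `∫‖U(s)‖⁶ ≤ w⁶` (`w ≥ 0`), `R ≥ 1`, `δ > 0`: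
`2∫φ_R²⟪DUΩ,Ω⟫ ≤ 2D_R + ((27/128)(1+δ)KS²w⁴)Z_R + 0·Z_∞ + ((2c₁²/δ + 4Cc₁)/R)I` (four-term shape of
`integral_sq_norm_lerayVorticity_le_of_forall_one_le`): `integral_mul_inner_stretching_eq`;
`|⟪U,DΩ Ω⟫| ≤ ‖U‖‖DΩ‖‖Ω‖`; Cauchy–Schwarz; Hölder `(3,3/2)`; the `L³` Gagliardo–Nirenberg inequality
for `φ_RΩ`; `‖D(φΩ)‖² ≤ (1+δ)φ²|∇Ω|²_F + (1+δ⁻¹)‖Dφ‖²‖Ω‖²`; `two_mul_le_of_le_mul_mul_cube` with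
`η = 1/(1+δ)`; collar `‖D(φ_R²)‖ ≤ 2c₁/R`, `‖U‖ ≤ C`. [folklore energy method; Gagliardo–Nirenberg] -/
theorem two_mul_integral_sqCutoff_stretching_le_lsix (hV : IsTypeIAncientMild C V) {c₁ : ℝ}
    (hc₁ : ∀ R : ℝ, 0 < R → ∀ y : (EuclideanSpace ℝ (Fin 3)),
      ‖fderiv ℝ (fun z : (EuclideanSpace ℝ (Fin 3)) => smoothTransition (2 - ‖z‖ ^ 2 / R ^ 2)) y‖ ≤ c₁ / R)
    {R : ℝ} (hR1 : 1 ≤ R) (s : ℝ) {w : ℝ} (hw : 0 ≤ w)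
    (hint6 : Integrable (fun y => ‖lerayOrbit V s y‖ ^ 6))
    (hw6 : ∫ y, ‖lerayOrbit V s y‖ ^ 6 ≤ w ^ 6) {δ : ℝ} (hδ : 0 < δ) :
    2 * (∫ y, smoothTransition (2 - ‖y‖ ^ 2 / R ^ 2) ^ 2 *
        ⟪fderiv ℝ (lerayOrbit V s) y (lerayVorticity V s y), lerayVorticity V s y⟫) ≤
      2 * (∫ y, smoothTransition (2 - ‖y‖ ^ 2 / R ^ 2) ^ 2 *
          frobeniusNormSq (fderiv ℝ (lerayVorticity V s) y)) +
        (27 / 128 * (1 + δ) * (SNormLESNormFDerivOfEqConst (EuclideanSpace ℝ (Fin 3))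
            (volume : Measure (EuclideanSpace ℝ (Fin 3))) 2 : ℝ) ^ 2 * w ^ 4) *
          (∫ y, smoothTransition (2 - ‖y‖ ^ 2 / R ^ 2) ^ 2 * ‖lerayVorticity V s y‖ ^ 2) +
        0 * (∫ y, ‖lerayVorticity V s y‖ ^ 2) +
        (2 * c₁ ^ 2 / δ + 4 * C * c₁) / R *
          ∫ y in closedBall (0 : EuclideanSpace ℝ (Fin 3)) (2 * R), ‖lerayVorticity V s y‖ ^ 2 := by
  have hR : 0 < R := lt_of_lt_of_le one_pos hR1
  have hC : 0 ≤ C := hV.nonneg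
  set KS : ℝ := (SNormLESNormFDerivOfEqConst (EuclideanSpace ℝ (Fin 3))
    (volume : Measure (EuclideanSpace ℝ (Fin 3))) 2 : ℝ) with hKSdef
  have hKS0 : 0 ≤ KS := NNReal.coe_nonneg _
  set φ₁ : (EuclideanSpace ℝ (Fin 3)) → ℝ := fun z => smoothTransition (2 - ‖z‖ ^ 2 / R ^ 2) with hφ₁def
  set φ : (EuclideanSpace ℝ (Fin 3)) → ℝ := fun z => φ₁ z ^ 2 with hφdef
  set Ω := lerayVorticity V s with hΩdef
  set U := lerayOrbit V s with hUdef
  have hφ₁1 : ContDiff ℝ 1 φ₁ := contDiff_smoothTransition_cutoff (n := 1) R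
  have hφ₁0 : ∀ y, 0 ≤ φ₁ y := fun y => smoothTransition_cutoff_nonneg R y
  have hφ₁z : ∀ y ∉ closedBall (0 : (EuclideanSpace ℝ (Fin 3))) (2 * R), φ₁ y = 0 := fun y hy =>
    smoothTransition_cutoff_eq_zero_of_notMem hR hy
  have hφ1 : ContDiff ℝ 1 φ := contDiff_sqCutoff (n := 1) R
  have hφc : HasCompactSupport φ := hasCompactSupport_sqCutoff hR
  have hφ0 : ∀ y, 0 ≤ φ y := fun y => sqCutoff_nonneg R y
  have hΩ1 : ContDiff ℝ 1 Ω := signedBudget_contDiff_lerayVorticity_slice hV s (n := 1)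
  have hU1 : ContDiff ℝ 1 U := mustSqueeze_contDiff_lerayOrbit_slice hV s (n := 1)
  have hUC : ∀ y, ‖U y‖ ≤ C := fun y => norm_lerayOrbit_le_of_typeI hV s y
  have hdivΩ : VectorCalculus.IsDivFree Ω := fun y =>
    divergence_curl_eq_zero_holds _
      ((contDiff_lerayOrbit_slice_of_typeI hV s (n := (⊤ : ℕ∞)) le_rfl).of_le (by norm_cast)) y
  have hcΩ : Continuous Ω := hΩ1.continuous
  have hcU : Continuous U := hU1.continuous
  have hcDΩ : Continuous (fderiv ℝ Ω) := hΩ1.continuous_fderiv one_ne_zero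
  have hcφ₁ : Continuous φ₁ := hφ₁1.continuous
  have hcDφ₁ : Continuous (fderiv ℝ φ₁) := hφ₁1.continuous_fderiv one_ne_zero
  have hcφ : Continuous φ := hφ1.continuous
  have hcDφ : Continuous (fderiv ℝ φ) := hφ1.continuous_fderiv one_ne_zero
  have hcF : Continuous fun y => frobeniusNormSq (fderiv ℝ Ω y) :=
    continuous_frobeniusNormSq_fderiv_lerayVorticity hV s
  have hcs : ∀ {f : (EuclideanSpace ℝ (Fin 3)) → ℝ},
      (∀ y ∉ closedBall (0 : (EuclideanSpace ℝ (Fin 3))) (2 * R), f y = 0) → HasCompactSupport f :=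
    fun hf => HasCompactSupport.intro (isCompact_closedBall (0 : (EuclideanSpace ℝ (Fin 3))) (2 * R)) hf
  have add_sq : ∀ p q : ℝ, (p + q) ^ 2 ≤ (1 + δ) * p ^ 2 + (1 + δ⁻¹) * q ^ 2 := fun p q => by
    have h : (1 + δ) * p ^ 2 + (1 + δ⁻¹) * q ^ 2 - (p + q) ^ 2 = (δ * p - q) ^ 2 / δ := by
      field_simp
      ring
    have h0 : 0 ≤ (δ * p - q) ^ 2 / δ := div_nonneg (sq_nonneg _) hδ.le
    linarith
  have hIBP := integral_mul_inner_stretching_eq hφ1 hφc hU1 hΩ1 hdivΩ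
  have hg1 : ContDiff ℝ 1 fun y => φ₁ y • Ω y := hφ₁1.smul hΩ1
  have hcg : Continuous fun y => φ₁ y • Ω y := hg1.continuous
  have hcDg : Continuous (fderiv ℝ fun y => φ₁ y • Ω y) := hg1.continuous_fderiv one_ne_zero
  have hg0 : ∀ y ∉ closedBall (0 : (EuclideanSpace ℝ (Fin 3))) (2 * R), φ₁ y • Ω y = 0 := fun y hy => by
    rw [hφ₁z y hy, zero_smul]
  have hgts : tsupport (fun y => φ₁ y • Ω y) ⊆ closedBall (0 : (EuclideanSpace ℝ (Fin 3))) (2 * R) :=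
    closure_minimal (fun y hy => by by_contra h; exact hy (hg0 y h)) isClosed_closedBall
  have hDg0 : ∀ y ∉ closedBall (0 : (EuclideanSpace ℝ (Fin 3))) (2 * R),
      fderiv ℝ (fun y => φ₁ y • Ω y) y = 0 := fun y hy =>
    fderiv_of_notMem_tsupport ℝ fun h => hy (hgts h)
  have hsn : ∀ n : ℕ, n ≠ 0 → HasCompactSupport fun y => ‖φ₁ y • Ω y‖ ^ n := fun n hn =>
    hcs fun y hy => by show ‖φ₁ y • Ω y‖ ^ n = 0; rw [hg0 y hy, norm_zero, zero_pow hn]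
  have hi2 : Integrable fun y => ‖φ₁ y • Ω y‖ ^ 2 :=
    (hcg.norm.pow 2).integrable_of_hasCompactSupport (hsn 2 two_ne_zero)
  have hi4 : Integrable fun y => ‖φ₁ y • Ω y‖ ^ 4 :=
    (hcg.norm.pow 4).integrable_of_hasCompactSupport (hsn 4 (by norm_num))
  have hi6 : Integrable fun y => ‖φ₁ y • Ω y‖ ^ 6 :=
    (hcg.norm.pow 6).integrable_of_hasCompactSupport (hsn 6 (by norm_num))
  have hiB : Integrable fun y => ‖fderiv ℝ (fun y => φ₁ y • Ω y) y‖ ^ 2 :=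
    (hcDg.norm.pow 2).integrable_of_hasCompactSupport
      (hcs fun y hy => by show ‖fderiv ℝ (fun y => φ₁ y • Ω y) y‖ ^ 2 = 0; rw [hDg0 y hy]; simp)
  set Sint : ℝ := -(∫ y, φ y * ⟪U y, fderiv ℝ Ω y (Ω y)⟫) with hSdef
  set P : ℝ := ∫ y, (‖U y‖ * (φ₁ y * ‖Ω y‖)) ^ 2 with hPdef
  set A : ℝ := ∫ y, ‖φ₁ y • Ω y‖ ^ 2 with hAdef
  set Z : ℝ := ∫ y, φ y * ‖Ω y‖ ^ 2 with hZdef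
  set B : ℝ := ∫ y, ‖fderiv ℝ (fun y => φ₁ y • Ω y) y‖ ^ 2 with hBdef
  set D : ℝ := ∫ y, φ y * frobeniusNormSq (fderiv ℝ Ω y) with hDdef
  set I : ℝ := ∫ y in closedBall (0 : (EuclideanSpace ℝ (Fin 3))) (2 * R), ‖Ω y‖ ^ 2 with hIdef
  set T3 : ℝ := ∫ y, ‖φ₁ y • Ω y‖ ^ 3 with hT3def
  set S6 : ℝ := ∫ y, ‖U y‖ ^ 6 with hS6def
  have hA0 : 0 ≤ A := integral_nonneg fun y => by positivity
  have hB0 : 0 ≤ B := integral_nonneg fun y => by positivity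
  have hI0 : 0 ≤ I := integral_nonneg fun y => by positivity
  have hD0 : 0 ≤ D := integral_nonneg fun y => mul_nonneg (hφ0 y) (frobeniusNormSq_nonneg _)
  have hZ0 : 0 ≤ Z := integral_nonneg fun y => mul_nonneg (hφ0 y) (sq_nonneg _)
  have hT30 : 0 ≤ T3 := integral_nonneg fun y => by positivity
  have hS60 : 0 ≤ S6 := integral_nonneg fun y => by positivity
  have hP0 : 0 ≤ P := integral_nonneg fun y => sq_nonneg _
  have hAZ : A = Z := integral_congr_ae (Eventually.of_forall fun y => by
    show ‖φ₁ y • Ω y‖ ^ 2 = φ y * ‖Ω y‖ ^ 2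
    rw [norm_smul, Real.norm_of_nonneg (hφ₁0 y), mul_pow])
  have hsf : HasCompactSupport fun y => ‖U y‖ * (φ₁ y * ‖Ω y‖) :=
    hcs fun y hy => by show ‖U y‖ * (φ₁ y * ‖Ω y‖) = 0; rw [hφ₁z y hy, zero_mul, mul_zero]
  have hsg : HasCompactSupport fun y => φ₁ y * ‖fderiv ℝ Ω y‖ :=
    hcs fun y hy => by show φ₁ y * ‖fderiv ℝ Ω y‖ = 0; rw [hφ₁z y hy, zero_mul]
  have hmf : MemLp (fun y => ‖U y‖ * (φ₁ y * ‖Ω y‖)) (ENNReal.ofReal 2) volume := by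
    rw [ENNReal.ofReal_ofNat]
    exact (hcU.norm.mul (hcφ₁.mul hcΩ.norm)).memLp_of_hasCompactSupport hsf
  have hmg : MemLp (fun y => φ₁ y * ‖fderiv ℝ Ω y‖) (ENNReal.ofReal 2) volume := by
    rw [ENNReal.ofReal_ofNat]
    exact (hcφ₁.mul hcDΩ.norm).memLp_of_hasCompactSupport hsg
  have iQ : Integrable fun y => φ y * ⟪U y, fderiv ℝ Ω y (Ω y)⟫ :=
    (hcφ.mul (hcU.inner (hcDΩ.clm_apply hcΩ))).integrable_of_hasCompactSupport hφc.mul_right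
  have iFG : Integrable fun y => (‖U y‖ * (φ₁ y * ‖Ω y‖)) * (φ₁ y * ‖fderiv ℝ Ω y‖) :=
    ((hcU.norm.mul (hcφ₁.mul hcΩ.norm)).mul (hcφ₁.mul hcDΩ.norm)).integrable_of_hasCompactSupport
      hsf.mul_right
  have hpt : ∀ y, -(φ y * ⟪U y, fderiv ℝ Ω y (Ω y)⟫) ≤
      (‖U y‖ * (φ₁ y * ‖Ω y‖)) * (φ₁ y * ‖fderiv ℝ Ω y‖) := by
    intro y
    have h1 : -⟪U y, fderiv ℝ Ω y (Ω y)⟫ ≤ ‖U y‖ * (‖fderiv ℝ Ω y‖ * ‖Ω y‖) := by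
      calc -⟪U y, fderiv ℝ Ω y (Ω y)⟫ ≤ ‖⟪U y, fderiv ℝ Ω y (Ω y)⟫‖ := by
            rw [Real.norm_eq_abs]; exact neg_le_abs _
        _ ≤ ‖U y‖ * ‖fderiv ℝ Ω y (Ω y)‖ := norm_inner_le_norm _ _
        _ ≤ ‖U y‖ * (‖fderiv ℝ Ω y‖ * ‖Ω y‖) :=
            mul_le_mul_of_nonneg_left (ContinuousLinearMap.le_opNorm _ _) (norm_nonneg _)
    have h2 := mul_le_mul_of_nonneg_left h1 (hφ0 y)
    calc -(φ y * ⟪U y, fderiv ℝ Ω y (Ω y)⟫) = φ y * -⟪U y, fderiv ℝ Ω y (Ω y)⟫ := by ring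
      _ ≤ φ y * (‖U y‖ * (‖fderiv ℝ Ω y‖ * ‖Ω y‖)) := h2
      _ = (‖U y‖ * (φ₁ y * ‖Ω y‖)) * (φ₁ y * ‖fderiv ℝ Ω y‖) := by rw [hφdef]; ring
  have hDop : (∫ y, (φ₁ y * ‖fderiv ℝ Ω y‖) ^ 2) ≤ D := by
    have iD : Integrable fun y => φ y * frobeniusNormSq (fderiv ℝ Ω y) :=
      (hcφ.mul hcF).integrable_of_hasCompactSupport hφc.mul_right
    have iL : Integrable fun y => (φ₁ y * ‖fderiv ℝ Ω y‖) ^ 2 :=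
      ((hcφ₁.mul hcDΩ.norm).pow 2).integrable_of_hasCompactSupport
        (hcs fun y hy => by show (φ₁ y * ‖fderiv ℝ Ω y‖) ^ 2 = 0; rw [hφ₁z y hy, zero_mul, sq, zero_mul])
    refine integral_mono iL iD fun y => ?_
    show (φ₁ y * ‖fderiv ℝ Ω y‖) ^ 2 ≤ φ y * frobeniusNormSq (fderiv ℝ Ω y)
    rw [mul_pow, hφdef]
    exact mul_le_mul_of_nonneg_left (sq_opNorm_le_frobeniusNormSq _) (sq_nonneg _)
  have hCS : Sint ≤ Real.sqrt P * Real.sqrt D := by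
    have h := integral_mul_le_Lp_mul_Lq_of_nonneg Real.HolderConjugate.two_two
      (Eventually.of_forall fun y => mul_nonneg (norm_nonneg _) (mul_nonneg (hφ₁0 y) (norm_nonneg _)))
      (Eventually.of_forall fun y => mul_nonneg (hφ₁0 y) (norm_nonneg _)) hmf hmg
    have e1 : ∫ y, (‖U y‖ * (φ₁ y * ‖Ω y‖)) ^ (2 : ℝ) = P := integral_congr_ae (Eventually.of_forall
      fun y => by show (‖U y‖ * (φ₁ y * ‖Ω y‖)) ^ (2 : ℝ) = (‖U y‖ * (φ₁ y * ‖Ω y‖)) ^ 2; rw [Real.rpow_two])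
    have e2 : ∫ y, (φ₁ y * ‖fderiv ℝ Ω y‖) ^ (2 : ℝ) = ∫ y, (φ₁ y * ‖fderiv ℝ Ω y‖) ^ 2 :=
      integral_congr_ae (Eventually.of_forall fun y => by
        show (φ₁ y * ‖fderiv ℝ Ω y‖) ^ (2 : ℝ) = (φ₁ y * ‖fderiv ℝ Ω y‖) ^ 2; rw [Real.rpow_two])
    rw [e1, e2, ← Real.sqrt_eq_rpow, ← Real.sqrt_eq_rpow] at h
    calc Sint = ∫ y, -(φ y * ⟪U y, fderiv ℝ Ω y (Ω y)⟫) := by rw [hSdef, integral_neg]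
      _ ≤ ∫ y, (‖U y‖ * (φ₁ y * ‖Ω y‖)) * (φ₁ y * ‖fderiv ℝ Ω y‖) := integral_mono iQ.neg iFG hpt
      _ ≤ Real.sqrt P * Real.sqrt (∫ y, (φ₁ y * ‖fderiv ℝ Ω y‖) ^ 2) := h
      _ ≤ Real.sqrt P * Real.sqrt D :=
          mul_le_mul_of_nonneg_left (Real.sqrt_le_sqrt hDop) (Real.sqrt_nonneg _)
  have h3 : (3 : ℝ).HolderConjugate (3 / 2) := Real.holderConjugate_iff.2 ⟨by norm_num, by norm_num⟩
  have hmU : MemLp (fun y => ‖U y‖ ^ 2) (ENNReal.ofReal 3) volume := by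
    rw [show ENNReal.ofReal 3 = (3 : ℝ≥0∞) by norm_num]
    have hae : AEStronglyMeasurable (fun y => ‖U y‖ ^ 2) volume := (hcU.norm.pow 2).aestronglyMeasurable
    refine (integrable_norm_rpow_iff hae (by norm_num) (by simp)).1 ?_
    refine hint6.congr (Eventually.of_forall fun y => ?_)
    show ‖U y‖ ^ 6 = ‖‖U y‖ ^ 2‖ ^ (3 : ℝ≥0∞).toReal
    rw [ENNReal.toReal_ofNat, Real.norm_of_nonneg (sq_nonneg _),
      show (3 : ℝ) = ((3 : ℕ) : ℝ) by norm_num, Real.rpow_natCast]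
    ring
  have hmG : MemLp (fun y => (φ₁ y * ‖Ω y‖) ^ 2) (ENNReal.ofReal (3 / 2)) volume := by
    have hc2 : Continuous fun y => (φ₁ y * ‖Ω y‖) ^ 2 := (hcφ₁.mul hcΩ.norm).pow 2
    exact hc2.memLp_of_hasCompactSupport
      (hcs fun y hy => by show (φ₁ y * ‖Ω y‖) ^ 2 = 0; rw [hφ₁z y hy, zero_mul, sq, zero_mul])
  have hPeq : P = ∫ y, ‖U y‖ ^ 2 * (φ₁ y * ‖Ω y‖) ^ 2 :=
    integral_congr_ae (Eventually.of_forall fun y => by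
      show (‖U y‖ * (φ₁ y * ‖Ω y‖)) ^ 2 = ‖U y‖ ^ 2 * (φ₁ y * ‖Ω y‖) ^ 2; ring)
  have hHolder : P ≤ S6 ^ (1 / (3 : ℝ)) * T3 ^ (1 / (3 / 2 : ℝ)) := by
    have h := integral_mul_le_Lp_mul_Lq_of_nonneg h3
      (Eventually.of_forall fun y => sq_nonneg ‖U y‖)
      (Eventually.of_forall fun y => sq_nonneg (φ₁ y * ‖Ω y‖)) hmU hmG
    have e1 : ∫ y, (‖U y‖ ^ 2) ^ (3 : ℝ) = S6 := integral_congr_ae (Eventually.of_forall fun y => by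
      show (‖U y‖ ^ 2) ^ (3 : ℝ) = ‖U y‖ ^ 6
      rw [show (3 : ℝ) = ((3 : ℕ) : ℝ) by norm_num, Real.rpow_natCast]; ring)
    have e2 : ∫ y, ((φ₁ y * ‖Ω y‖) ^ 2) ^ (3 / 2 : ℝ) = T3 := integral_congr_ae (Eventually.of_forall
      fun y => by
        show ((φ₁ y * ‖Ω y‖) ^ 2) ^ (3 / 2 : ℝ) = ‖φ₁ y • Ω y‖ ^ 3
        rw [norm_smul, Real.norm_of_nonneg (hφ₁0 y), ← Real.rpow_natCast (φ₁ y * ‖Ω y‖) 2,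
          ← Real.rpow_mul (mul_nonneg (hφ₁0 y) (norm_nonneg _))]
        norm_num)
    rw [e1, e2] at h
    rwa [hPeq]
  have hS : S6 ^ (1 / (3 : ℝ)) ≤ w ^ 2 := by
    have h1 : S6 ^ (1 / (3 : ℝ)) ≤ (w ^ 6) ^ (1 / (3 : ℝ)) := Real.rpow_le_rpow hS60 hw6 (by norm_num)
    have e : (w ^ 6) ^ (1 / (3 : ℝ)) = w ^ 2 := by
      rw [← Real.rpow_natCast w 6, ← Real.rpow_mul hw, ← Real.rpow_natCast w 2]; norm_num
    rwa [e] at h1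
  have hGN : T3 ≤ KS ^ (3 / 2 : ℝ) * A ^ (3 / 4 : ℝ) * B ^ (3 / 4 : ℝ) := by
    have h := integral_norm_pow_three_le_of_integrable (volume : Measure (EuclideanSpace ℝ (Fin 3)))
      finrank_euclideanSpace_fin hg1 hi2 hi4 hi6 hiB
    rw [← hKSdef] at h
    exact h
  have hT : T3 ^ (1 / (3 / 2 : ℝ)) ≤ KS * (Real.sqrt A * Real.sqrt B) := by
    have hrhs0 : 0 ≤ KS ^ (3 / 2 : ℝ) * A ^ (3 / 4 : ℝ) * B ^ (3 / 4 : ℝ) := by positivity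
    have h1 : T3 ^ (1 / (3 / 2 : ℝ)) ≤ (KS ^ (3 / 2 : ℝ) * A ^ (3 / 4 : ℝ) * B ^ (3 / 4 : ℝ)) ^ (1 / (3 / 2 : ℝ)) :=
      Real.rpow_le_rpow hT30 hGN (by norm_num)
    have e : (KS ^ (3 / 2 : ℝ) * A ^ (3 / 4 : ℝ) * B ^ (3 / 4 : ℝ)) ^ (1 / (3 / 2 : ℝ)) =
        KS * (Real.sqrt A * Real.sqrt B) := by
      rw [Real.mul_rpow (by positivity) (by positivity), Real.mul_rpow (by positivity) (by positivity),
        ← Real.rpow_mul hKS0, ← Real.rpow_mul hA0, ← Real.rpow_mul hB0, Real.sqrt_eq_rpow,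
        Real.sqrt_eq_rpow]
      norm_num
      ring
    rwa [e] at h1
  have hPle : P ≤ w ^ 2 * (KS * (Real.sqrt A * Real.sqrt B)) :=
    hHolder.trans (mul_le_mul hS hT (Real.rpow_nonneg hT30 _) (sq_nonneg _))
  have hDg : ∀ y, ‖fderiv ℝ (fun y => φ₁ y • Ω y) y‖ ^ 2 ≤ (1 + δ) * (φ y * frobeniusNormSq (fderiv ℝ Ω y)) +
      (1 + δ⁻¹) * (‖fderiv ℝ φ₁ y‖ ^ 2 * ‖Ω y‖ ^ 2) := by
    intro y
    have hdφ : DifferentiableAt ℝ φ₁ y := hφ₁1.differentiable one_ne_zero y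
    have hdΩ : DifferentiableAt ℝ Ω y := hΩ1.differentiable one_ne_zero y
    have e : fderiv ℝ (fun y => φ₁ y • Ω y) y = φ₁ y • fderiv ℝ Ω y + (fderiv ℝ φ₁ y).smulRight (Ω y) :=
      (hdφ.hasFDerivAt.smul hdΩ.hasFDerivAt).fderiv
    have hn : ‖fderiv ℝ (fun y => φ₁ y • Ω y) y‖ ≤ φ₁ y * ‖fderiv ℝ Ω y‖ + ‖fderiv ℝ φ₁ y‖ * ‖Ω y‖ := by
      rw [e]
      refine (norm_add_le _ _).trans (add_le_add ?_ ?_)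
      · rw [norm_smul, Real.norm_of_nonneg (hφ₁0 y)]
      · exact (ContinuousLinearMap.norm_smulRight_apply _ _).le
    have hop : ‖fderiv ℝ Ω y‖ ^ 2 ≤ frobeniusNormSq (fderiv ℝ Ω y) := sq_opNorm_le_frobeniusNormSq _
    have hop' : φ y * ‖fderiv ℝ Ω y‖ ^ 2 ≤ φ y * frobeniusNormSq (fderiv ℝ Ω y) :=
      mul_le_mul_of_nonneg_left hop (hφ0 y)
    have hδ1 : 0 ≤ 1 + δ := by linarith
    calc ‖fderiv ℝ (fun y => φ₁ y • Ω y) y‖ ^ 2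
        ≤ (φ₁ y * ‖fderiv ℝ Ω y‖ + ‖fderiv ℝ φ₁ y‖ * ‖Ω y‖) ^ 2 :=
          pow_le_pow_left₀ (norm_nonneg _) hn 2
      _ ≤ (1 + δ) * (φ₁ y * ‖fderiv ℝ Ω y‖) ^ 2 + (1 + δ⁻¹) * (‖fderiv ℝ φ₁ y‖ * ‖Ω y‖) ^ 2 := add_sq _ _
      _ = (1 + δ) * (φ y * ‖fderiv ℝ Ω y‖ ^ 2) + (1 + δ⁻¹) * (‖fderiv ℝ φ₁ y‖ ^ 2 * ‖Ω y‖ ^ 2) := by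
          rw [hφdef]; ring
      _ ≤ (1 + δ) * (φ y * frobeniusNormSq (fderiv ℝ Ω y)) + (1 + δ⁻¹) * (‖fderiv ℝ φ₁ y‖ ^ 2 * ‖Ω y‖ ^ 2) := by
          have := mul_le_mul_of_nonneg_left hop' hδ1
          linarith
  have iD : Integrable fun y => φ y * frobeniusNormSq (fderiv ℝ Ω y) :=
    (hcφ.mul hcF).integrable_of_hasCompactSupport hφc.mul_right
  have hDφ0 : ∀ y ∉ closedBall (0 : (EuclideanSpace ℝ (Fin 3))) (2 * R), ‖fderiv ℝ φ₁ y‖ ^ 2 = 0 := fun y hy => by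
    rw [hφ₁def, signedBudget_fderiv_cutoff_eq_zero hR hy, norm_zero]; ring
  have iC : Integrable fun y => ‖fderiv ℝ φ₁ y‖ ^ 2 * ‖Ω y‖ ^ 2 :=
    ((hcDφ₁.norm.pow 2).mul (hcΩ.norm.pow 2)).integrable_of_hasCompactSupport
      (hcs fun y hy => by show ‖fderiv ℝ φ₁ y‖ ^ 2 * ‖Ω y‖ ^ 2 = 0; rw [hDφ0 y hy, zero_mul])
  have hcollar : (∫ y, ‖fderiv ℝ φ₁ y‖ ^ 2 * ‖Ω y‖ ^ 2) ≤ (c₁ / R) ^ 2 * I := by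
    refine (le_abs_self _).trans (abs_integral_le_of_weight_sq hcΩ (w := fun y => ‖fderiv ℝ φ₁ y‖ ^ 2)
      (hcDφ₁.norm.pow 2) hDφ0 (fun y _ => ?_) (fun y => ?_))
    · exact pow_le_pow_left₀ (norm_nonneg _) (hc₁ R hR y) 2
    · rw [abs_of_nonneg (by positivity)]
  have hδi : 0 ≤ 1 + δ⁻¹ := by positivity
  set B' : ℝ := (1 + δ) * D + (1 + δ⁻¹) * ((c₁ / R) ^ 2 * I) with hB'def
  have hBle : B ≤ B' := by
    calc B ≤ ∫ y, ((1 + δ) * (φ y * frobeniusNormSq (fderiv ℝ Ω y)) +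
          (1 + δ⁻¹) * (‖fderiv ℝ φ₁ y‖ ^ 2 * ‖Ω y‖ ^ 2)) :=
          integral_mono hiB ((iD.const_mul (1 + δ)).add (iC.const_mul (1 + δ⁻¹))) hDg
      _ = (1 + δ) * D + (1 + δ⁻¹) * ∫ y, ‖fderiv ℝ φ₁ y‖ ^ 2 * ‖Ω y‖ ^ 2 := by
          rw [integral_add (iD.const_mul (1 + δ)) (iC.const_mul (1 + δ⁻¹)), integral_const_mul,
            integral_const_mul]
      _ ≤ B' := by
          have := mul_le_mul_of_nonneg_left hcollar hδi
          rw [hB'def]; linarith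
  have hB'0 : 0 ≤ B' := hB0.trans hBle
  have hDB' : D ≤ B' / (1 + δ) := by
    rw [le_div_iff₀ (by positivity), hB'def]
    have : 0 ≤ (1 + δ⁻¹) * ((c₁ / R) ^ 2 * I) := by positivity
    linarith
  set a : ℝ := Real.sqrt (Real.sqrt Z) with hadef
  set b : ℝ := Real.sqrt (Real.sqrt B') with hbdef
  have ha0 : 0 ≤ a := Real.sqrt_nonneg _
  have hb0 : 0 ≤ b := Real.sqrt_nonneg _
  have ha2 : a ^ 2 = Real.sqrt Z := Real.sq_sqrt (Real.sqrt_nonneg _)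
  have hb2 : b ^ 2 = Real.sqrt B' := Real.sq_sqrt (Real.sqrt_nonneg _)
  have ha4 : a ^ 4 = Z := by rw [show a ^ 4 = (a ^ 2) ^ 2 by ring, ha2, Real.sq_sqrt hZ0]
  have hb4 : b ^ 4 = B' := by rw [show b ^ 4 = (b ^ 2) ^ 2 by ring, hb2, Real.sq_sqrt hB'0]
  set θ : ℝ := w * Real.sqrt KS / Real.sqrt (1 + δ) with hθdef
  have hθ0 : 0 ≤ θ := div_nonneg (mul_nonneg hw (Real.sqrt_nonneg _)) (Real.sqrt_nonneg _)
  have hwab : 0 ≤ w * Real.sqrt KS * a * b :=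
    mul_nonneg (mul_nonneg (mul_nonneg hw (Real.sqrt_nonneg _)) ha0) hb0
  have hSθ : Sint ≤ θ * a * b ^ 3 := by
    -- `√P ≤ w √KS a b`, `√D ≤ b²/√(1+δ)`
    have hP' : P ≤ (w * Real.sqrt KS * a * b) ^ 2 := by
      have e : (w * Real.sqrt KS * a * b) ^ 2 = w ^ 2 * (KS * (a ^ 2 * b ^ 2)) := by
        rw [show (w * Real.sqrt KS * a * b) ^ 2 = w ^ 2 * (Real.sqrt KS ^ 2 * (a ^ 2 * b ^ 2)) by ring,
          Real.sq_sqrt hKS0]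
      rw [e, ha2, hb2, ← hAZ]
      refine hPle.trans (mul_le_mul_of_nonneg_left (mul_le_mul_of_nonneg_left ?_ hKS0) (sq_nonneg _))
      exact mul_le_mul_of_nonneg_left (Real.sqrt_le_sqrt hBle) (Real.sqrt_nonneg _)
    have hsP : Real.sqrt P ≤ w * Real.sqrt KS * a * b := by
      have := Real.sqrt_le_sqrt hP'
      rwa [Real.sqrt_sq hwab] at this
    have hsD : Real.sqrt D ≤ b ^ 2 / Real.sqrt (1 + δ) := by
      have h1 : Real.sqrt D ≤ Real.sqrt (B' / (1 + δ)) := Real.sqrt_le_sqrt hDB'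
      rwa [Real.sqrt_div hB'0, ← hb2] at h1
    calc Sint ≤ Real.sqrt P * Real.sqrt D := hCS
      _ ≤ (w * Real.sqrt KS * a * b) * (b ^ 2 / Real.sqrt (1 + δ)) :=
          mul_le_mul hsP hsD (Real.sqrt_nonneg _) hwab
      _ = θ * a * b ^ 3 := by rw [hθdef]; ring
  have hη : 0 < 1 / (1 + δ) := by positivity
  have hY := two_mul_le_of_le_mul_mul_cube hSθ hθ0 ha0 hb0 hη
  rw [ha4, hb4] at hY
  have hcoefZ : 27 * θ ^ 4 / (128 * (1 / (1 + δ)) ^ 3) = 27 / 128 * (1 + δ) * KS ^ 2 * w ^ 4 :=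
    coef_enstrophy_eq hδ hKS0 w
  have hcoefB : 2 * (1 / (1 + δ)) * B' = 2 * D + 2 / δ * ((c₁ / R) ^ 2 * I) :=
    coef_dissipation_eq hδ D ((c₁ / R) ^ 2 * I)
  rw [hcoefZ, hcoefB] at hY
  have hR2 : (c₁ / R) ^ 2 ≤ c₁ ^ 2 / R := div_sq_le_sq_div_of_one_le c₁ hR1
  have hJ : 2 / δ * ((c₁ / R) ^ 2 * I) ≤ (2 * c₁ ^ 2 / δ) / R * I := by
    have := mul_le_mul_of_nonneg_left (mul_le_mul_of_nonneg_right hR2 hI0) (by positivity : (0:ℝ) ≤ 2 / δ)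
    calc 2 / δ * ((c₁ / R) ^ 2 * I) ≤ 2 / δ * (c₁ ^ 2 / R * I) := this
      _ = (2 * c₁ ^ 2 / δ) / R * I := by ring
  have hcol : |∫ y, fderiv ℝ φ y (Ω y) * ⟪U y, Ω y⟫| ≤
      C * (2 * (c₁ / R)) * I := by
    refine abs_integral_le_of_weight_sq hcΩ (w := fun y => C * ‖fderiv ℝ φ y‖)
      (continuous_const.mul hcDφ.norm) (fun y hy => ?_) (fun y _ => ?_) (fun y => ?_)
    · show C * ‖fderiv ℝ φ y‖ = 0
      rw [hφdef, hφ₁def, fderiv_sqCutoff_eq_zero hR hy, norm_zero, mul_zero]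
    · show C * ‖fderiv ℝ φ y‖ ≤ C * (2 * (c₁ / R))
      exact mul_le_mul_of_nonneg_left (norm_fderiv_sqCutoff_le hc₁ hR y) hC
    · rw [abs_mul]
      have e1 : |fderiv ℝ φ y (Ω y)| ≤ ‖fderiv ℝ φ y‖ * ‖Ω y‖ := by
        rw [← Real.norm_eq_abs]; exact ContinuousLinearMap.le_opNorm _ _
      have e2 : |⟪U y, Ω y⟫| ≤ C * ‖Ω y‖ := by
        rw [← Real.norm_eq_abs]
        exact (norm_inner_le_norm _ _).trans (mul_le_mul_of_nonneg_right (hUC y) (norm_nonneg _))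
      calc |fderiv ℝ φ y (Ω y)| * |⟪U y, Ω y⟫| ≤ (‖fderiv ℝ φ y‖ * ‖Ω y‖) * (C * ‖Ω y‖) :=
            mul_le_mul e1 e2 (abs_nonneg _) (by positivity)
        _ = C * ‖fderiv ℝ φ y‖ * ‖Ω y‖ ^ 2 := by ring
  have hcol' : -(∫ y, fderiv ℝ φ y (Ω y) * ⟪U y, Ω y⟫) ≤ (2 * C * c₁) / R * I := by
    refine (neg_le_abs _).trans (hcol.trans (le_of_eq ?_))
    ring
  rw [hIBP, zero_mul, add_zero]
  have hsplit : (2 * c₁ ^ 2 / δ + 4 * C * c₁) / R * I =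
      (2 * c₁ ^ 2 / δ) / R * I + 2 * ((2 * C * c₁) / R * I) := by ring
  rw [hsplit]
  linarith [hY, hJ, hcol']

end Stretching

end Summit.NavierStokesRegularity.NavierStokesRegularity.Theorems.FiniteDissipationLiouville.VelocityLSix

end
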